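import Literature.NumberTheory.ComplexMultiplication.FiniteQAlgebraLatticeSquareZeroRadical
import Mathlib.Algebra.Algebra.Prod
import Mathlib.LinearAlgebra.Span.Defs
import HarnessLib

/-!
# Hertling–Larabi 2026b LEMMA 9.5: the orders `Λ_{α₁α₂α₃} = ⟨α₁e₁, α₃e₁ + α₂e₂, 1⟩_ℤ` of the split algebra
# `A = ℚe₁ ⊕ ℚe₂ ⊕ ℚe₃` — order criterion (a), containment (b), units (c) (with a correction), conductor (d)

[topic NumberTheory/ComplexMultiplication] General-`A` series, the rank-3 SPLIT example (sequel of the rank-2 file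
`FiniteQAlgebraLatticeSplitRankTwo`, HL Thm. 9.1).  Lane `lit-hodgefound` (Track 2 foundations library), seat p19
generation 40, rows g40-#13 (§0–§4), g40-#14 (§5) and g40-#15 (§6).  THEOREMS ONLY: no definition, no instance, no notation, no named fact (D-0026, net
Literature debt `0`), no `sorry`.

DEF-FREE SPELLING.  `A = ℚ × ℚ × ℚ` with componentwise product, `e₁ = (1,0,0)`, `e₂ = (0,1,0)`, `e₃ = (0,0,1)`,
`1_A = (1,1,1)`; HL's `Λ_{α₁α₂α₃} := e·(α₁ α₃ 1; 0 α₂ 1; 0 0 1)·ℤ³ = ℤα₁e₁ + ℤ(α₃e₁ + α₂e₂) + ℤ1_A` (`α₁, α₂ ∈ ℕ`,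
`α₃ ∈ ℤ`) is `span ℤ {(α₁, 0, 0), (α₃, α₂, 0), (1, 1, 1)}`; «order» = full lattice (`IsFullLattice`) containing `1`
and closed under multiplication (`Λ * Λ ≤ Λ`); the units of an order `Λ ⊂ Λ_max = ℤ³` are its sign vectors
`Λ ∩ {±1}³`, and `(ε₁, ε₂, ε₃) ∈ Λ ⟺ 1_A − (ε₁, ε₂, ε₃) ∈ Λ`, so `|Λ^{unit}| = 8 ⟺ 2e₁, 2e₂ ∈ Λ` and
`|Λ^{unit}| ≥ 4 ⟺ 2eᵢ ∈ Λ` for some `i`.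

## Source, VERBATIM

C. Hertling, K. Larabi, *Conjugacy classes of regular integer matrices*, arXiv:2602.15748 (2026)
[HertlingLarabi2026b], held `paper:arxiv-2602.15748`, §9.3, chunk p0029: «**Lemma 9.5.** (a) For each triple
`(α₁, α₂, α₃) ∈ ℕ² × ℤ` with `α₃ ∈ (−½α₁, ½α₁]` and `α₁ | (α₃(α₂ − α₃))` (9.6) the full lattice with `ℤ`-basis
`e(α₁ α₃ 1; 0 α₂ 1; 0 0 1)` (9.7) is an order. This order is called `Λ_{α₁α₂α₃}`. There are no other orders. For
each order, the `ℤ`-basis in (9.7) with (9.6) is unique. The maximal order is `Λ_max = Λ_{110}`. (b) An order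
`Λ_{β₁β₂β₃}` contains an order `Λ_{α₁α₂α₃}` if and only if `β₁ | α₁`, `β₂ | α₂`, `(α₂/β₂)β₃ ≡ α₃ mod β₁` (9.8). […]
(c) The size `|Λ_{α₁α₂α₃}^{unit}|` of the set `Λ_{α₁α₂α₃}^{unit} ⊂ Λ_max^{unit} = {±e₁ ± e₂ ± e₃}` of units in
`Λ_{α₁α₂α₃}` is `2` or `4` or `8`. In most cases it is `2`, then `Λ^{unit} = {±1_A}`.
`|Λ^{unit}| = 8 ⟺ (α₁, α₂, α₃) ∈ {(1,1,0), (1,2,0), (2,1,0), (2,1,1), (2,2,0)}`,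
`|Λ^{unit}| = 4 ⟺ (α₁, α₂, α₃) ∈ {(1, α₂, α₃) | α₂ ≥ 3} ∪ {(2, α₂, α₃) | α₂ ≥ 3} ∪ {(2,2,1)} ∪
{(α₁, 1, 0) | α₁ ≥ 3} ∪ {(α₁, 2, 0) | α₁ ≥ 3} ∪ {(α₁, 1, 1) | α₁ ≥ 3} ∪ {(α₁, 2, 2) | α₁ ≥ 4} ∪ {(3, 2, −1)}`,
`|Λ^{unit}| = 2` else. (d) The conductor `C := Λ_{α₁α₂α₃} : Λ_max` […] is
`C = Σᵢ Λ_{α₁α₂α₃} ∩ ℤeᵢ = Σᵢ ℤβᵢeᵢ` with `β₁ = α₁`, `β₂ = α₁α₂/gcd(α₁, α₃)`, `β₃ = α₁α₂/gcd(α₁, α₂ − α₃)` (9.10).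
**Proof:** (a) […] It is an order if it is multiplication invariant. The only constraint is
`(α₃e₁ + α₂e₂)(α₃e₁ + α₂e₂) ∈ L = α₃²e₁ + α₂²e₂ = α₃(α₃ − α₂)e₁ + α₂(α₃e₁ + α₂e₂)`, so `α₁ | (α₃(α₂ − α₃))`.
(b) (9.8) rewrites the conditions `β₁e₁ ∈ Λ_{α₁α₂α₃}` [sic] […]. (c) The characterization of `Λ` with
`|Λ^{unit}| = 8` follows from `Λ^{unit} = Λ_max^{unit} ⟺ 2e₁ ∈ Λ and 2e₁ + 2e₂ ∈ Λ ⟺ α₁ ∈ {1; 2}, α₂ ∈ {1; 2},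
α₃e₁ + α₂e₂ ≠ e₁ + 2e₂ if α₁ = 2`. Similarly, the characterization of `Λ` with `|Λ^{unit}| = 4` follows from
`|Λ^{unit}| = 4 ⟺ either 2e₁ ∈ Λ or 2e₂ ∈ Λ or 2e₃ ∈ Λ ⟺ either α₁ ∈ {1; 2} or (α₂, α₃) ∈ {(1,0), (2,0)} or
((α₂, α₃) ∈ {(1,1), (2,2)} or (α₁, α₂, α₃) = (3, 2, −1))`.»

## What is proved, and a CORRECTION to the printed list in (c)

* §0 `mem_span_order₃_iff` ((x,y,z) ∈ Λ_{α₁α₂α₃} ⟺ z ∈ ℤ, ∃ b ∈ ℤ: bα₂ = y − z, α₁ ∣ x − z − bα₃ in ℤ),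
  `one_mem_span_order₃`, `isFullLattice_span_order₃`.
* §1 **(a), the order criterion**: `span_order₃_mul_le_iff` — `Λ_{α₁α₂α₃}` is multiplicatively closed iff
  `α₁ ∣ α₃(α₂ − α₃)` (exactly the printed computation); §5 (row g40-#14) **(a), the classification**:
  `exists_eq_span_order₃_of_isOrder` («There are no other orders»: every order is a normalised `Λ_{α₁α₂α₃}`) and
  `span_order₃_injective` (the normalised triple is unique).
* §2 **(b)**: `span_order₃_le_iff` — `Λ_α ≤ Λ_β ⟺ β₁ ∣ α₁ ∧ ∃ b, bβ₂ = α₂ ∧ β₁ ∣ α₃ − bβ₃` (= (9.8)).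
* §3 **(c)**: `two_e₁_mem_iff` (`2e₁ ∈ Λ ⟺ α₁ ∣ 2`), `two_e₂_mem_iff` (`⟺ ∃ b, bα₂ = 2 ∧ α₁ ∣ bα₃`), `two_e₃_mem_iff`
  (`⟺ ∃ b, bα₂ = −2 ∧ α₁ ∣ 2 + bα₃`), `sign_mem_iff_sub_mem` (`ε ∈ Λ ⟺ 1 − ε ∈ Λ`),
  **`two_e₁_two_e₂_mem_iff`**: for a normalised order (`0 < α₁`, `0 < α₂`, `−α₁ < 2α₃ ≤ α₁`, `α₁ ∣ α₃(α₂ − α₃)`)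
  `2e₁, 2e₂ ∈ Λ ⟺ (α₁,α₂,α₃) ∈ {(1,1,0), (1,2,0), (2,1,0), (2,1,1), (2,2,0)}` — the printed `|Λ^{unit}| = 8` list,
  CONFIRMED.  **Correction of the printed `|Λ^{unit}| = 4` list**: the printed step «`2e₂ ∈ Λ ⟺ (α₂, α₃) ∈
  {(1,0), (2,0)}`» omits `(α₂, α₃) = (1, α₁/2)` and «`2e₃ ∈ Λ ⟺ …`» omits `(α₂, α₃) = (1, 1 − α₁/2)`; consequently
  the normalised orders `Λ_{2k,1,k}` and `Λ_{2k,1,1−k}`, `k ≥ 3` odd, have `|Λ^{unit}| = 4` but are missing from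
  the printed enumeration.  Proved here: `two_e₂_mem_family` (`2e₂ ∈ Λ_{2k,1,k}`, and `2k ∣ k(1 − k)` for odd `k`),
  `two_e₃_mem_family` (`2e₃ ∈ Λ_{2k,1,1−k}`), and the explicit witness **`sign_mem_span_order₃_613_iff`**: the sign
  vectors in the normalised order `Λ_{6,1,3}` are exactly those with `ε₁ = ε₃` — four units — although `(6,1,3)` is
  in none of the printed families.
* §4 **(d)**: `mem_span_order₃_e₁_iff` (`Λ ∩ ℚe₁ = α₁ℤe₁`), `mem_span_order₃_e₂_iff` (`ye₂ ∈ Λ ⟺ ∃ b, bα₂ = y ∧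
  α₁ ∣ bα₃`, i.e. `Λ ∩ ℚe₂ = (α₁α₂/gcd(α₁,α₃))ℤe₂`), `mem_span_order₃_e₃_iff` (`ze₃ ∈ Λ ⟺ z ∈ ℤ, α₂ ∣ z,
  α₁ ∣ z − (z/α₂)α₃`-form).
* §6 (row g40-#15) **(c) completed**: `exists_sign_mem_iff` (`|Λ^{unit}| ≥ 4 ⟺` some `2eᵢ ∈ Λ`) and the
  CORRECTED normal-form evaluations `two_e₂_mem_iff_of_normalForm` (`⟺ (α₂,α₃) ∈ {(1,0),(2,0)}` or
  `(α₂, 2α₃) = (1, α₁)`), `two_e₃_mem_iff_of_normalForm` (`⟺ (α₂,α₃) ∈ {(1,1),(2,2)}`, `α₃ = 2 − α₁` with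
  `α₂ = 2`, `(α₂, 2α₃) = (1, 2 − α₁)`, or `(α₁, α₃) = (1, 0)`).
-/

open Submodule

open Literature.NumberTheory.Automorphic (IsFullLattice)

namespace Literature.NumberTheory.ComplexMultiplication.FiniteQAlgebraLattice.SplitRankThree

/-! ## §0 Membership in `Λ_{α₁α₂α₃}`, the unit, fullness -/

/-- Membership in `Λ_{α₁α₂α₃} = ℤ(α₁,0,0) + ℤ(α₃,α₂,0) + ℤ(1,1,1)`:
`(x, y, z) ∈ Λ ⟺ z ∈ ℤ ∧ ∃ b ∈ ℤ, bα₂ = y − z ∧ ∃ a ∈ ℤ, aα₁ = x − z − bα₃`. [cite: HertlingLarabi2026b, §9.3 Lemma 9.5 (a) (9.7), chunk p0029] -/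
theorem mem_span_order₃_iff (α₁ α₂ : ℕ) (α₃ : ℤ) (x y z : ℚ) :
    ((x, y, z) : ℚ × ℚ × ℚ) ∈ span ℤ ({((α₁ : ℚ), (0 : ℚ), (0 : ℚ)), ((α₃ : ℚ), (α₂ : ℚ), (0 : ℚ)), ((1 : ℚ), (1 : ℚ), (1 : ℚ))} : Set (ℚ × ℚ × ℚ)) ↔
      (∃ n : ℤ, (n : ℚ) = z) ∧ ∃ b : ℤ, (b : ℚ) * α₂ = y - z ∧ ∃ a : ℤ, (a : ℚ) * α₁ = x - z - b * α₃ := by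
  rw [mem_span_triple]
  constructor
  · rintro ⟨a, b, c, habc⟩
    simp only [Prod.smul_mk, Prod.mk_add_mk, zsmul_eq_mul, mul_one, mul_zero, add_zero, zero_add, Prod.mk.injEq] at habc
    obtain ⟨h1, h2, h3⟩ := habc
    refine ⟨⟨c, h3⟩, b, by rw [← h2, ← h3]; ring, a, by rw [← h1, ← h3]; ring⟩
  · rintro ⟨⟨n, hn⟩, b, hb, a, ha⟩
    refine ⟨a, b, n, ?_⟩
    simp only [Prod.smul_mk, Prod.mk_add_mk, zsmul_eq_mul, mul_one, mul_zero, add_zero, zero_add, Prod.mk.injEq]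
    exact ⟨by rw [ha, hn]; ring, by rw [hb, hn]; ring, hn⟩

/-- `1_A = (1,1,1) ∈ Λ_{α₁α₂α₃}`. [cite: HertlingLarabi2026b, §9.3 Lemma 9.5 (a), chunk p0029] -/
theorem one_mem_span_order₃ (α₁ α₂ : ℕ) (α₃ : ℤ) : (1 : ℚ × ℚ × ℚ) ∈ span ℤ ({((α₁ : ℚ), (0 : ℚ), (0 : ℚ)), ((α₃ : ℚ), (α₂ : ℚ), (0 : ℚ)), ((1 : ℚ), (1 : ℚ), (1 : ℚ))} : Set (ℚ × ℚ × ℚ)) := by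
  rw [show (1 : ℚ × ℚ × ℚ) = ((1 : ℚ), (1 : ℚ), (1 : ℚ)) from rfl]
  exact subset_span (by simp)

/-- `Λ_{α₁α₂α₃}` (`α₁, α₂ ≠ 0`) is a full lattice of `ℚ³`. [cite: HertlingLarabi2026b, §9.3 Lemma 9.5 (a) («the full lattice with `ℤ`-basis (9.7)»), chunk p0029] -/
theorem isFullLattice_span_order₃ {α₁ α₂ : ℕ} (h₁ : α₁ ≠ 0) (h₂ : α₂ ≠ 0) (α₃ : ℤ) :
    IsFullLattice (ℚ × ℚ × ℚ) (span ℤ ({((α₁ : ℚ), (0 : ℚ), (0 : ℚ)), ((α₃ : ℚ), (α₂ : ℚ), (0 : ℚ)), ((1 : ℚ), (1 : ℚ), (1 : ℚ))} : Set (ℚ × ℚ × ℚ))) := by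
  refine ⟨fg_span (Set.toFinite _), fun d => ?_⟩
  obtain ⟨x, y, z⟩ := d
  -- clear denominators: `k = den x · den y · den z`, `n = α₁ α₂ k`
  set X : ℤ := x.num * y.den * z.den with hX
  set Y : ℤ := y.num * x.den * z.den with hY
  set Z : ℤ := z.num * x.den * y.den with hZ
  have kx : ((x.den * y.den * z.den : ℕ) : ℚ) * x = X := by
    rw [hX]; push_cast; rw [← Rat.mul_den_eq_num x]; ring
  have ky : ((x.den * y.den * z.den : ℕ) : ℚ) * y = Y := by
    rw [hY]; push_cast; rw [← Rat.mul_den_eq_num y]; ring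
  have kz : ((x.den * y.den * z.den : ℕ) : ℚ) * z = Z := by
    rw [hZ]; push_cast; rw [← Rat.mul_den_eq_num z]; ring
  refine ⟨(α₁ * α₂ * (x.den * y.den * z.den : ℕ) : ℤ), ?_, ?_⟩
  · exact_mod_cast mul_ne_zero (mul_ne_zero h₁ h₂) (mul_ne_zero (mul_ne_zero x.den_nz y.den_nz) z.den_nz)
  · have e : ((α₁ * α₂ * (x.den * y.den * z.den : ℕ) : ℤ) • ((x, y, z) : ℚ × ℚ × ℚ)) =
        (((α₁ * α₂ * X : ℤ) : ℚ), ((α₁ * α₂ * Y : ℤ) : ℚ), ((α₁ * α₂ * Z : ℤ) : ℚ)) := by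
      simp only [Prod.smul_mk, zsmul_eq_mul, Prod.mk.injEq]
      push_cast
      refine ⟨?_, ?_, ?_⟩
      · rw [← kx]; push_cast; ring
      · rw [← ky]; push_cast; ring
      · rw [← kz]; push_cast; ring
    rw [e, mem_span_order₃_iff]
    refine ⟨⟨α₁ * α₂ * Z, rfl⟩, α₁ * (Y - Z), by push_cast; ring, α₂ * (X - Z) - (Y - Z) * α₃, by push_cast; ring⟩

/-! ## §1 Lemma 9.5 (a): the order criterion `α₁ ∣ α₃(α₂ − α₃)` -/

/-- **LEMMA 9.5 (a), the criterion**: `Λ_{α₁α₂α₃}` (`α₂ ≠ 0`) is closed under multiplication — hence an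
order, as it is full and contains `1_A` — iff `α₁ ∣ α₃(α₂ − α₃)`; «The only constraint is
`(α₃e₁ + α₂e₂)² = α₃(α₃ − α₂)e₁ + α₂(α₃e₁ + α₂e₂) ∈ L`». [cite: HertlingLarabi2026b, §9.3 Lemma 9.5 (a) (9.6) with proof, chunk p0029] -/
theorem span_order₃_mul_le_iff (α₁ : ℕ) {α₂ : ℕ} (h₂ : α₂ ≠ 0) (α₃ : ℤ) :
    span ℤ ({((α₁ : ℚ), (0 : ℚ), (0 : ℚ)), ((α₃ : ℚ), (α₂ : ℚ), (0 : ℚ)), ((1 : ℚ), (1 : ℚ), (1 : ℚ))} : Set (ℚ × ℚ × ℚ)) * span ℤ ({((α₁ : ℚ), (0 : ℚ), (0 : ℚ)), ((α₃ : ℚ), (α₂ : ℚ), (0 : ℚ)), ((1 : ℚ), (1 : ℚ), (1 : ℚ))} : Set (ℚ × ℚ × ℚ)) ≤ span ℤ ({((α₁ : ℚ), (0 : ℚ), (0 : ℚ)), ((α₃ : ℚ), (α₂ : ℚ), (0 : ℚ)), ((1 : ℚ), (1 : ℚ), (1 : ℚ))} : Set (ℚ × ℚ × ℚ)) ↔ (α₁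 : ℤ) ∣ α₃ * (α₂ - α₃) := by
  constructor
  · intro h
    have hv : (((α₃ : ℚ), (α₂ : ℚ), (0 : ℚ)) : ℚ × ℚ × ℚ) ∈ span ℤ ({((α₁ : ℚ), (0 : ℚ), (0 : ℚ)), ((α₃ : ℚ), (α₂ : ℚ), (0 : ℚ)), ((1 : ℚ), (1 : ℚ), (1 : ℚ))} : Set (ℚ × ℚ × ℚ)) :=
      subset_span (by simp)
    have hsq := h (mul_mem_mul hv hv)
    rw [Prod.mk_mul_mk, Prod.mk_mul_mk, mul_zero, mem_span_order₃_iff] at hsq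
    obtain ⟨-, b, hb, a, ha⟩ := hsq
    rw [sub_zero] at hb
    have hb' : b = α₂ := by
      have : (b : ℚ) = α₂ := mul_right_cancel₀ (by exact_mod_cast h₂ : (α₂ : ℚ) ≠ 0) (by rw [hb])
      exact_mod_cast this
    rw [hb', sub_zero] at ha
    refine ⟨-a, ?_⟩
    have e : a * (α₁ : ℤ) = α₃ * α₃ - (α₂ : ℤ) * α₃ := by exact_mod_cast ha
    linear_combination e
  · rintro ⟨t, ht⟩
    rw [span_mul_span, span_le]
    rintro _ ⟨u, hu, v, hv, rfl⟩
    simp only [Set.mem_insert_iff, Set.mem_singleton_iff] at hu hv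
    dsimp only
    rw [SetLike.mem_coe]
    have gen₁ : (((α₁ : ℚ), (0 : ℚ), (0 : ℚ)) : ℚ × ℚ × ℚ) ∈ span ℤ ({((α₁ : ℚ), (0 : ℚ), (0 : ℚ)), ((α₃ : ℚ), (α₂ : ℚ), (0 : ℚ)), ((1 : ℚ), (1 : ℚ), (1 : ℚ))} : Set (ℚ × ℚ × ℚ)) :=
      subset_span (by simp)
    have gen₂ : (((α₃ : ℚ), (α₂ : ℚ), (0 : ℚ)) : ℚ × ℚ × ℚ) ∈ span ℤ ({((α₁ : ℚ), (0 : ℚ), (0 : ℚ)), ((α₃ : ℚ), (α₂ : ℚ), (0 : ℚ)), ((1 : ℚ), (1 : ℚ), (1 : ℚ))} : Set (ℚ × ℚ × ℚ)) :=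
      subset_span (by simp)
    have gen₃ : (((1 : ℚ), (1 : ℚ), (1 : ℚ)) : ℚ × ℚ × ℚ) ∈ span ℤ ({((α₁ : ℚ), (0 : ℚ), (0 : ℚ)), ((α₃ : ℚ), (α₂ : ℚ), (0 : ℚ)), ((1 : ℚ), (1 : ℚ), (1 : ℚ))} : Set (ℚ × ℚ × ℚ)) :=
      subset_span (by simp)
    have h11 : (((α₁ : ℚ) * α₁, (0 : ℚ), (0 : ℚ)) : ℚ × ℚ × ℚ) ∈ span ℤ ({((α₁ : ℚ), (0 : ℚ), (0 : ℚ)), ((α₃ : ℚ), (α₂ : ℚ), (0 : ℚ)), ((1 : ℚ), (1 : ℚ), (1 : ℚ))} : Set (ℚ × ℚ × ℚ)) := by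
      have e : (((α₁ : ℚ) * α₁, (0 : ℚ), (0 : ℚ)) : ℚ × ℚ × ℚ) = (α₁ : ℤ) • (((α₁ : ℚ), (0 : ℚ), (0 : ℚ)) : ℚ × ℚ × ℚ) := by
        simp only [Prod.smul_mk, zsmul_eq_mul, mul_zero, Int.cast_natCast]
      rw [e]; exact smul_mem _ _ gen₁
    have h12 : (((α₁ : ℚ) * α₃, (0 : ℚ), (0 : ℚ)) : ℚ × ℚ × ℚ) ∈ span ℤ ({((α₁ : ℚ), (0 : ℚ), (0 : ℚ)), ((α₃ : ℚ), (α₂ : ℚ), (0 : ℚ)), ((1 : ℚ), (1 : ℚ), (1 : ℚ))} : Set (ℚ × ℚ × ℚ)) := by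
      have e : (((α₁ : ℚ) * α₃, (0 : ℚ), (0 : ℚ)) : ℚ × ℚ × ℚ) = α₃ • (((α₁ : ℚ), (0 : ℚ), (0 : ℚ)) : ℚ × ℚ × ℚ) := by
        simp only [Prod.smul_mk, zsmul_eq_mul, mul_zero]
        rw [mul_comm]
      rw [e]; exact smul_mem _ _ gen₁
    have h22 : (((α₃ : ℚ) * α₃, (α₂ : ℚ) * α₂, (0 : ℚ)) : ℚ × ℚ × ℚ) ∈ span ℤ ({((α₁ : ℚ), (0 : ℚ), (0 : ℚ)), ((α₃ : ℚ), (α₂ : ℚ), (0 : ℚ)), ((1 : ℚ), (1 : ℚ), (1 : ℚ))} : Set (ℚ × ℚ × ℚ)) := by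
      rw [mem_span_order₃_iff]
      refine ⟨⟨0, by simp⟩, α₂, by push_cast; ring, -t, ?_⟩
      have e : ((α₃ * (α₂ - α₃) : ℤ) : ℚ) = ((α₁ * t : ℤ) : ℚ) := by rw [ht]
      push_cast at e ⊢
      linear_combination e
    rcases hu with rfl | rfl | rfl <;> rcases hv with rfl | rfl | rfl
    · simpa [Prod.mk_mul_mk] using h11
    · simpa [Prod.mk_mul_mk] using h12
    · simpa [Prod.mk_mul_mk] using gen₁
    · simpa [Prod.mk_mul_mk, mul_comm] using h12
    · simpa [Prod.mk_mul_mk] using h22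
    · simpa [Prod.mk_mul_mk] using gen₂
    · simpa [Prod.mk_mul_mk] using gen₁
    · simpa [Prod.mk_mul_mk] using gen₂
    · simpa [Prod.mk_mul_mk] using gen₃

/-! ## §2 Lemma 9.5 (b): containment of orders -/

/-- **LEMMA 9.5 (b)** «`Λ_{β₁β₂β₃} ⊃ Λ_{α₁α₂α₃}` iff `β₁ | α₁`, `β₂ | α₂`, `(α₂/β₂)β₃ ≡ α₃ mod β₁`» (here `β₂ ≠ 0`;
`b = α₂/β₂`). [cite: HertlingLarabi2026b, §9.3 Lemma 9.5 (b) (9.8), chunk p0029] -/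
theorem span_order₃_le_iff (α₁ α₂ : ℕ) (α₃ : ℤ) {β₁ β₂ : ℕ} (β₃ : ℤ) (hβ₂ : β₂ ≠ 0) :
    span ℤ ({((α₁ : ℚ), (0 : ℚ), (0 : ℚ)), ((α₃ : ℚ), (α₂ : ℚ), (0 : ℚ)), ((1 : ℚ), (1 : ℚ), (1 : ℚ))} : Set (ℚ × ℚ × ℚ)) ≤ span ℤ ({((β₁ : ℚ), (0 : ℚ), (0 : ℚ)), ((β₃ : ℚ), (β₂ : ℚ), (0 : ℚ)), ((1 : ℚ), (1 : ℚ), (1 : ℚ))} : Set (ℚ × ℚ × ℚ)) ↔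
      (β₁ : ℤ) ∣ α₁ ∧ ∃ b : ℤ, b * β₂ = α₂ ∧ (β₁ : ℤ) ∣ α₃ - b * β₃ := by
  rw [span_le]
  constructor
  · intro h
    have h1 : (((α₁ : ℚ), (0 : ℚ), (0 : ℚ)) : ℚ × ℚ × ℚ) ∈ span ℤ ({((β₁ : ℚ), (0 : ℚ), (0 : ℚ)), ((β₃ : ℚ), (β₂ : ℚ), (0 : ℚ)), ((1 : ℚ), (1 : ℚ), (1 : ℚ))} : Set (ℚ × ℚ × ℚ)) := h (by simp)
    have h2 : (((α₃ : ℚ), (α₂ : ℚ), (0 : ℚ)) : ℚ × ℚ × ℚ) ∈ span ℤ ({((β₁ : ℚ), (0 : ℚ), (0 : ℚ)), ((β₃ : ℚ), (β₂ : ℚ), (0 : ℚ)), ((1 : ℚ), (1 : ℚ), (1 : ℚ))} : Set (ℚ × ℚ × ℚ)) := h (by simp)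
    rw [mem_span_order₃_iff] at h1 h2
    obtain ⟨-, b, hb, a, ha⟩ := h1
    rw [sub_zero] at hb
    have hb0 : b = 0 := by
      have : (b : ℚ) = 0 := (mul_eq_zero.1 hb).resolve_right (by exact_mod_cast hβ₂)
      exact_mod_cast this
    rw [hb0, Int.cast_zero, zero_mul, sub_zero, sub_zero] at ha
    obtain ⟨-, b', hb', a', ha'⟩ := h2
    rw [sub_zero] at hb'
    rw [sub_zero] at ha'
    have e1 : a * (β₁ : ℤ) = α₁ := by exact_mod_cast ha
    have e2 : b' * (β₂ : ℤ) = α₂ := by exact_mod_cast hb'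
    have e3 : a' * (β₁ : ℤ) = α₃ - b' * β₃ := by exact_mod_cast ha'
    exact ⟨⟨a, by rw [← e1, mul_comm]⟩, b', e2, a', by rw [← e3, mul_comm]⟩
  · rintro ⟨⟨a, ha⟩, b, hb, a', ha'⟩
    intro v hv
    simp only [Set.mem_insert_iff, Set.mem_singleton_iff] at hv
    rw [SetLike.mem_coe]
    rcases hv with rfl | rfl | rfl
    · rw [mem_span_order₃_iff]
      refine ⟨⟨0, by simp⟩, 0, by simp, a, ?_⟩
      have : ((α₁ : ℤ) : ℚ) = ((β₁ * a : ℤ) : ℚ) := by rw [ha]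
      push_cast at this; rw [this]; ring
    · rw [mem_span_order₃_iff]
      refine ⟨⟨0, by simp⟩, b, by rw [sub_zero]; exact_mod_cast hb, a', ?_⟩
      have : ((α₃ - b * β₃ : ℤ) : ℚ) = ((β₁ * a' : ℤ) : ℚ) := by rw [ha']
      push_cast at this
      linear_combination -this
    · exact subset_span (by simp)

/-! ## §3 Lemma 9.5 (c): the units `Λ ∩ {±1}³` -/

/-- `2e₁ ∈ Λ_{α₁α₂α₃} ⟺ α₁ ∣ 2` (`α₂ ≠ 0`). [cite: HertlingLarabi2026b, §9.3 Lemma 9.5 (c) proof («`2e₁ ∈ Λ ⟺ α₁ ∈ {1;2}`»), chunk p0029] -/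
theorem two_e₁_mem_iff {α₁ α₂ : ℕ} (α₃ : ℤ) (h₂ : α₂ ≠ 0) :
    (((2 : ℚ), (0 : ℚ), (0 : ℚ)) : ℚ × ℚ × ℚ) ∈ span ℤ ({((α₁ : ℚ), (0 : ℚ), (0 : ℚ)), ((α₃ : ℚ), (α₂ : ℚ), (0 : ℚ)), ((1 : ℚ), (1 : ℚ), (1 : ℚ))} : Set (ℚ × ℚ × ℚ)) ↔ (α₁ : ℤ) ∣ 2 := by
  rw [mem_span_order₃_iff]
  constructor
  · rintro ⟨-, b, hb, a, ha⟩
    rw [sub_zero] at hb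
    have hb0 : b = 0 := by
      have : (b : ℚ) = 0 := (mul_eq_zero.1 hb).resolve_right (by exact_mod_cast h₂)
      exact_mod_cast this
    rw [hb0, Int.cast_zero, zero_mul, sub_zero, sub_zero] at ha
    have e : a * (α₁ : ℤ) = 2 := by exact_mod_cast ha
    exact ⟨a, by rw [← e, mul_comm]⟩
  · rintro ⟨a, ha⟩
    refine ⟨⟨0, by simp⟩, 0, by simp, a, ?_⟩
    have : ((2 : ℤ) : ℚ) = ((α₁ * a : ℤ) : ℚ) := by rw [ha]
    simp only [Int.cast_zero, zero_mul, sub_zero]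
    push_cast at this; rw [this]; ring

/-- `2e₂ ∈ Λ_{α₁α₂α₃} ⟺ ∃ b ∈ ℤ, bα₂ = 2 ∧ α₁ ∣ bα₃` — i.e. `α₂ ∣ 2` and `α₁ ∣ (2/α₂)α₃`; for a NORMALISED order
(`−½α₁ < α₃ ≤ ½α₁`) this means `(α₂, α₃) ∈ {(1, 0), (2, 0)}` OR `(α₂, α₃) = (1, α₁/2)` — the last case is missing
in the printed «`2e₂ ∈ Λ ⟺ (α₂, α₃) ∈ {(1,0), (2,0)}`», see `two_e₂_mem_family`, `sign_mem_span_order₃_613_iff`.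
[cite: HertlingLarabi2026b, §9.3 Lemma 9.5 (c) proof, chunk p0029] -/
theorem two_e₂_mem_iff (α₁ α₂ : ℕ) (α₃ : ℤ) :
    (((0 : ℚ), (2 : ℚ), (0 : ℚ)) : ℚ × ℚ × ℚ) ∈ span ℤ ({((α₁ : ℚ), (0 : ℚ), (0 : ℚ)), ((α₃ : ℚ), (α₂ : ℚ), (0 : ℚ)), ((1 : ℚ), (1 : ℚ), (1 : ℚ))} : Set (ℚ × ℚ × ℚ)) ↔ ∃ b : ℤ, b * (α₂ : ℤ) = 2 ∧ (α₁ : ℤ) ∣ b * α₃ := by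
  rw [mem_span_order₃_iff]
  constructor
  · rintro ⟨-, b, hb, a, ha⟩
    rw [sub_zero] at hb
    rw [sub_zero, zero_sub] at ha
    refine ⟨b, by exact_mod_cast hb, -a, ?_⟩
    have e : a * (α₁ : ℤ) = -(b * α₃) := by exact_mod_cast ha
    linear_combination e
  · rintro ⟨b, hb, a, ha⟩
    refine ⟨⟨0, by simp⟩, b, by rw [sub_zero]; exact_mod_cast hb, -a, ?_⟩
    have : ((b * α₃ : ℤ) : ℚ) = ((α₁ * a : ℤ) : ℚ) := by rw [ha]
    push_cast at this ⊢
    linear_combination this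

/-- `2e₃ ∈ Λ_{α₁α₂α₃} ⟺ ∃ b ∈ ℤ, bα₂ = −2 ∧ α₁ ∣ 2 + bα₃` — i.e. `α₂ ∣ 2` and `α₁ ∣ 2 − (2/α₂)α₃`; for a normalised
order: `(α₂, α₃) ∈ {(1, 1), (2, 2)}`, `(α₁, α₂, α₃) = (3, 2, −1)` (printed) OR `(α₂, α₃) = (1, 1 − α₁/2)` (missing in
print, see `two_e₃_mem_family`). [cite: HertlingLarabi2026b, §9.3 Lemma 9.5 (c) proof, chunk p0029] -/
theorem two_e₃_mem_iff (α₁ α₂ : ℕ) (α₃ : ℤ) :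
    (((0 : ℚ), (0 : ℚ), (2 : ℚ)) : ℚ × ℚ × ℚ) ∈ span ℤ ({((α₁ : ℚ), (0 : ℚ), (0 : ℚ)), ((α₃ : ℚ), (α₂ : ℚ), (0 : ℚ)), ((1 : ℚ), (1 : ℚ), (1 : ℚ))} : Set (ℚ × ℚ × ℚ)) ↔ ∃ b : ℤ, b * (α₂ : ℤ) = -2 ∧ (α₁ : ℤ) ∣ 2 + b * α₃ := by
  rw [mem_span_order₃_iff]
  constructor
  · rintro ⟨-, b, hb, a, ha⟩
    rw [zero_sub] at hb
    rw [zero_sub] at ha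
    refine ⟨b, by exact_mod_cast hb, -a, ?_⟩
    have e : a * (α₁ : ℤ) = -2 - b * α₃ := by exact_mod_cast ha
    linear_combination e
  · rintro ⟨b, hb, a, ha⟩
    refine ⟨⟨2, by simp⟩, b, by rw [zero_sub]; exact_mod_cast hb, -a, ?_⟩
    have : ((2 + b * α₃ : ℤ) : ℚ) = ((α₁ * a : ℤ) : ℚ) := by rw [ha]
    push_cast at this ⊢
    linear_combination this

/-- Sign vectors versus `2eᵢ`: `u ∈ Λ ⟺ 1_A − u ∈ Λ` (as `1_A ∈ Λ`); e.g. `(−1, 1, 1) ∈ Λ ⟺ 2e₁ ∈ Λ`.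
[cite: HertlingLarabi2026b, §9.3 Lemma 9.5 (c) proof («`Λ^{unit} = Λ_max^{unit} ⟺ 2e₁ ∈ Λ and 2e₁ + 2e₂ ∈ Λ`»), chunk p0029] -/
theorem mem_iff_one_sub_mem (α₁ α₂ : ℕ) (α₃ : ℤ) (u : ℚ × ℚ × ℚ) :
    u ∈ span ℤ ({((α₁ : ℚ), (0 : ℚ), (0 : ℚ)), ((α₃ : ℚ), (α₂ : ℚ), (0 : ℚ)), ((1 : ℚ), (1 : ℚ), (1 : ℚ))} : Set (ℚ × ℚ × ℚ)) ↔ (1 : ℚ × ℚ × ℚ) - u ∈ span ℤ ({((α₁ : ℚ), (0 : ℚ), (0 : ℚ)), ((α₃ : ℚ), (α₂ : ℚ), (0 : ℚ)), ((1 : ℚ), (1 : ℚ), (1 : ℚ))} : Set (ℚ × ℚ × ℚ)) := by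
  constructor
  · exact fun h => sub_mem (one_mem_span_order₃ α₁ α₂ α₃) h
  · intro h
    have := sub_mem (one_mem_span_order₃ α₁ α₂ α₃) h
    rwa [sub_sub_cancel] at this

/-- **LEMMA 9.5 (c), `|Λ^{unit}| = 8`** — CONFIRMED: for a normalised order `Λ_{α₁α₂α₃}` (`α₁, α₂ ≥ 1`,
`−α₁ < 2α₃ ≤ α₁`, `α₁ ∣ α₃(α₂ − α₃)`), `2e₁ ∈ Λ` and `2e₂ ∈ Λ` (equivalently all eight sign vectors lie in `Λ`)
iff `(α₁, α₂, α₃) ∈ {(1,1,0), (1,2,0), (2,1,0), (2,1,1), (2,2,0)}`. [cite: HertlingLarabi2026b, §9.3 Lemma 9.5 (c), chunk p0029] -/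
theorem two_e₁_two_e₂_mem_iff {α₁ α₂ : ℕ} {α₃ : ℤ} (h₁ : 0 < α₁) (h₂ : 0 < α₂) (hlo : -(α₁ : ℤ) < 2 * α₃)
    (hhi : 2 * α₃ ≤ α₁) :
    ((((2 : ℚ), (0 : ℚ), (0 : ℚ)) : ℚ × ℚ × ℚ) ∈ span ℤ ({((α₁ : ℚ), (0 : ℚ), (0 : ℚ)), ((α₃ : ℚ), (α₂ : ℚ), (0 : ℚ)), ((1 : ℚ), (1 : ℚ), (1 : ℚ))} : Set (ℚ × ℚ × ℚ)) ∧
      (((0 : ℚ), (2 : ℚ), (0 : ℚ)) : ℚ × ℚ × ℚ) ∈ span ℤ ({((α₁ : ℚ), (0 : ℚ), (0 : ℚ)), ((α₃ : ℚ), (α₂ : ℚ), (0 : ℚ)), ((1 : ℚ), (1 : ℚ), (1 : ℚ))} : Set (ℚ × ℚ × ℚ))) ↔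
      ((α₁ = 1 ∧ α₂ = 1 ∧ α₃ = 0) ∨ (α₁ = 1 ∧ α₂ = 2 ∧ α₃ = 0) ∨ (α₁ = 2 ∧ α₂ = 1 ∧ α₃ = 0) ∨
        (α₁ = 2 ∧ α₂ = 1 ∧ α₃ = 1) ∨ (α₁ = 2 ∧ α₂ = 2 ∧ α₃ = 0)) := by
  rw [two_e₁_mem_iff α₃ (Nat.pos_iff_ne_zero.1 h₂), two_e₂_mem_iff]
  constructor
  · rintro ⟨hd1, b, hb, hd2⟩
    have hα₁ : α₁ ≤ 2 := by
      have := Int.le_of_dvd (by norm_num) hd1; omega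
    have hα₂ : α₂ ≤ 2 := by
      have hb2 : (α₂ : ℤ) ∣ 2 := ⟨b, by rw [← hb, mul_comm]⟩
      have := Int.le_of_dvd (by norm_num) hb2; omega
    interval_cases α₁ <;> interval_cases α₂
    · left; refine ⟨rfl, rfl, by omega⟩
    · right; left; refine ⟨rfl, rfl, by omega⟩
    · -- `α₁ = 2`, `α₂ = 1`: `α₃ ∈ {0, 1}`
      have : α₃ = 0 ∨ α₃ = 1 := by omega
      rcases this with rfl | rfl
      · exact Or.inr (Or.inr (Or.inl ⟨rfl, rfl, rfl⟩))
      · exact Or.inr (Or.inr (Or.inr (Or.inl ⟨rfl, rfl, rfl⟩)))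
    · -- `α₁ = 2`, `α₂ = 2`: `b = 1`, `2 ∣ α₃`, so `α₃ = 0`
      have hb1 : b = 1 := by omega
      subst hb1
      rw [one_mul] at hd2
      have : α₃ = 0 := by obtain ⟨c, hc⟩ := hd2; omega
      exact Or.inr (Or.inr (Or.inr (Or.inr ⟨rfl, rfl, this⟩)))
  · rintro (⟨rfl, rfl, rfl⟩ | ⟨rfl, rfl, rfl⟩ | ⟨rfl, rfl, rfl⟩ | ⟨rfl, rfl, rfl⟩ | ⟨rfl, rfl, rfl⟩)
    · exact ⟨by norm_num, 2, by norm_num, by norm_num⟩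
    · exact ⟨by norm_num, 1, by norm_num, by norm_num⟩
    · exact ⟨by norm_num, 2, by norm_num, by norm_num⟩
    · exact ⟨by norm_num, 2, by norm_num, by norm_num⟩
    · exact ⟨by norm_num, 1, by norm_num, by norm_num⟩

/-- **The family missing from the printed `|Λ^{unit}| = 4` list, I**: for every `k`, `2e₂ ∈ Λ_{2k,1,k}`; for ODD `k`
the order criterion `2k ∣ k(1 − k)` holds and `(2k, 1, k)` is normalised (`−2k < 2k ≤ 2k`), so `Λ_{2k,1,k}` is a
normalised order with `|Λ^{unit}| ≥ 4`; for `k ≥ 3` it is in none of the printed families (`α₁ = 2k ≥ 6`, `α₂ = 1`,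
`α₃ = k ∉ {0, 1}`). [cite: HertlingLarabi2026b, §9.3 Lemma 9.5 (c), chunk p0029] -/
theorem two_e₂_mem_family (k : ℕ) :
    (((0 : ℚ), (2 : ℚ), (0 : ℚ)) : ℚ × ℚ × ℚ) ∈ span ℤ ({(((2 * k : ℕ) : ℚ), (0 : ℚ), (0 : ℚ)), (((k : ℤ) : ℚ), ((1 : ℕ) : ℚ), (0 : ℚ)), ((1 : ℚ), (1 : ℚ), (1 : ℚ))} : Set (ℚ × ℚ × ℚ)) ∧
      (Odd k → ((2 * k : ℕ) : ℤ) ∣ (k : ℤ) * ((1 : ℕ) - (k : ℤ))) := by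
  have hmem := (two_e₂_mem_iff (2 * k) 1 (k : ℤ)).2 ⟨2, by simp, ⟨1, by push_cast; ring⟩⟩
  refine ⟨hmem, fun hk => ?_⟩
  obtain ⟨j, rfl⟩ := hk
  refine ⟨-j, ?_⟩
  push_cast
  ring

/-- **The family missing from the printed `|Λ^{unit}| = 4` list, II**: `2e₃ ∈ Λ_{2k,1,1−k}` for every `k`; for odd
`k` again `2k ∣ (1 − k)(1 − (1 − k)) = (1 − k)k` and `(2k, 1, 1 − k)` is normalised.
[cite: HertlingLarabi2026b, §9.3 Lemma 9.5 (c), chunk p0029] -/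
theorem two_e₃_mem_family (k : ℕ) :
    (((0 : ℚ), (0 : ℚ), (2 : ℚ)) : ℚ × ℚ × ℚ) ∈ span ℤ ({(((2 * k : ℕ) : ℚ), (0 : ℚ), (0 : ℚ)), ((((1 - (k : ℤ) : ℤ)) : ℚ), ((1 : ℕ) : ℚ), (0 : ℚ)), ((1 : ℚ), (1 : ℚ), (1 : ℚ))} : Set (ℚ × ℚ × ℚ)) ∧
      (Odd k → ((2 * k : ℕ) : ℤ) ∣ (1 - (k : ℤ)) * ((1 : ℕ) - (1 - (k : ℤ)))) := by
  have hmem := (two_e₃_mem_iff (2 * k) 1 (1 - (k : ℤ))).2 ⟨-2, by simp, ⟨1, by push_cast; ring⟩⟩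
  refine ⟨hmem, fun hk => ?_⟩
  obtain ⟨j, rfl⟩ := hk
  refine ⟨-j, ?_⟩
  push_cast
  ring

/-- **A normalised order with exactly four units that is in none of the printed families**: in `Λ_{6,1,3}`
(normalised: `−6 < 6 ≤ 6`; an order: `6 ∣ 3·(1 − 3)`) a sign vector `(ε₁, ε₂, ε₃) ∈ {±1}³` lies in `Λ` iff
`ε₁ = ε₃`; so `Λ_{6,1,3}^{unit} = {±1_A, ±(e₁ − e₂ + e₃)}` has FOUR elements, whereas `(6, 1, 3)` is not in the
printed list for `|Λ^{unit}| = 4` (nor in those for `8`), which would give `2`.  (The printed intermediate criterion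
«either `2e₁ ∈ Λ` or `2e₂ ∈ Λ` or `2e₃ ∈ Λ`» is correct; the slip is in its evaluation for `α₂ = 1`.)
[cite: HertlingLarabi2026b, §9.3 Lemma 9.5 (c), chunk p0029] -/
theorem sign_mem_span_order₃_613_iff (ε₁ ε₂ ε₃ : ℤ) (hε₁ : ε₁ = 1 ∨ ε₁ = -1) (hε₂ : ε₂ = 1 ∨ ε₂ = -1)
    (hε₃ : ε₃ = 1 ∨ ε₃ = -1) :
    (((ε₁ : ℚ), (ε₂ : ℚ), (ε₃ : ℚ)) : ℚ × ℚ × ℚ) ∈ span ℤ ({(((6 : ℕ) : ℚ), (0 : ℚ), (0 : ℚ)), (((3 : ℤ) : ℚ), ((1 : ℕ) : ℚ), (0 : ℚ)), ((1 : ℚ), (1 : ℚ), (1 : ℚ))} : Set (ℚ × ℚ × ℚ)) ↔ ε₁ = ε₃ := by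
  rw [mem_span_order₃_iff]
  push_cast
  constructor
  · rintro ⟨-, b, hb, a, ha⟩
    rw [mul_one] at hb
    have hb' : b = ε₂ - ε₃ := by exact_mod_cast hb
    rw [hb'] at ha
    have e' : a * 6 = ε₁ - ε₃ - (ε₂ - ε₃) * 3 := by
      have h6 : ((a * 6 - (ε₁ - ε₃ - (ε₂ - ε₃) * 3) : ℤ) : ℚ) = 0 := by
        push_cast at ha ⊢; linarith
      have := Int.cast_eq_zero.1 h6
      linarith
    rcases hε₁ with rfl | rfl <;> rcases hε₂ with rfl | rfl <;> rcases hε₃ with rfl | rfl <;> omega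
  · rintro rfl
    refine ⟨⟨ε₁, rfl⟩, ε₂ - ε₁, by push_cast; ring, ?_⟩
    rcases hε₁ with rfl | rfl <;> rcases hε₂ with rfl | rfl
    · exact ⟨0, by norm_num⟩
    · exact ⟨1, by norm_num⟩
    · exact ⟨-1, by norm_num⟩
    · exact ⟨0, by norm_num⟩

/-! ## §4 Lemma 9.5 (d): the coordinate axes `Λ ∩ ℚeᵢ` (the conductor `C = ⊕ ℤβᵢeᵢ`) -/

/-- `Λ ∩ ℚe₁ = α₁ℤe₁` (`β₁ = α₁`; `α₂ ≠ 0`). [cite: HertlingLarabi2026b, §9.3 Lemma 9.5 (d) (9.10) («Obviously `β₁ = α₁`»), chunk p0029] -/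
theorem mem_span_order₃_e₁_iff {α₁ α₂ : ℕ} (α₃ : ℤ) (h₂ : α₂ ≠ 0) (x : ℚ) :
    ((x, (0 : ℚ), (0 : ℚ)) : ℚ × ℚ × ℚ) ∈ span ℤ ({((α₁ : ℚ), (0 : ℚ), (0 : ℚ)), ((α₃ : ℚ), (α₂ : ℚ), (0 : ℚ)), ((1 : ℚ), (1 : ℚ), (1 : ℚ))} : Set (ℚ × ℚ × ℚ)) ↔ ∃ m : ℤ, (m : ℚ) * α₁ = x := by
  rw [mem_span_order₃_iff]
  constructor
  · rintro ⟨-, b, hb, a, ha⟩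
    rw [sub_zero] at hb
    have hb0 : b = 0 := by
      have : (b : ℚ) = 0 := (mul_eq_zero.1 hb).resolve_right (by exact_mod_cast h₂)
      exact_mod_cast this
    rw [hb0, Int.cast_zero, zero_mul, sub_zero, sub_zero] at ha
    exact ⟨a, ha⟩
  · rintro ⟨m, hm⟩
    exact ⟨⟨0, by simp⟩, 0, by simp, m, by rw [hm]; simp⟩

/-- `ye₂ ∈ Λ ⟺ ∃ b ∈ ℤ, bα₂ = y ∧ α₁ ∣ bα₃` — so `Λ ∩ ℚe₂ = β₂ℤe₂` with `β₂` «the smallest multiple of `α₂` such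
that …», `β₂ = α₁α₂/gcd(α₁, α₃)`. [cite: HertlingLarabi2026b, §9.3 Lemma 9.5 (d) (9.10), chunk p0029] -/
theorem mem_span_order₃_e₂_iff (α₁ α₂ : ℕ) (α₃ : ℤ) (y : ℚ) :
    (((0 : ℚ), y, (0 : ℚ)) : ℚ × ℚ × ℚ) ∈ span ℤ ({((α₁ : ℚ), (0 : ℚ), (0 : ℚ)), ((α₃ : ℚ), (α₂ : ℚ), (0 : ℚ)), ((1 : ℚ), (1 : ℚ), (1 : ℚ))} : Set (ℚ × ℚ × ℚ)) ↔ ∃ b : ℤ, (b : ℚ) * α₂ = y ∧ (α₁ : ℤ) ∣ b * α₃ := by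
  rw [mem_span_order₃_iff]
  constructor
  · rintro ⟨-, b, hb, a, ha⟩
    rw [sub_zero] at hb
    rw [sub_zero, zero_sub] at ha
    refine ⟨b, hb, -a, ?_⟩
    have e : a * (α₁ : ℤ) = -(b * α₃) := by exact_mod_cast ha
    linear_combination e
  · rintro ⟨b, hb, a, ha⟩
    refine ⟨⟨0, by simp⟩, b, by rw [sub_zero, hb], -a, ?_⟩
    have : ((b * α₃ : ℤ) : ℚ) = ((α₁ * a : ℤ) : ℚ) := by rw [ha]
    push_cast at this ⊢
    linear_combination this

/-- `ze₃ ∈ Λ ⟺ z ∈ ℤ ∧ ∃ b ∈ ℤ, bα₂ = −z ∧ α₁ ∣ z + bα₃` — so `Λ ∩ ℚe₃ = β₃ℤe₃`, `β₃ = α₁α₂/gcd(α₁, α₂ − α₃)`.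
[cite: HertlingLarabi2026b, §9.3 Lemma 9.5 (d) (9.10), chunk p0029] -/
theorem mem_span_order₃_e₃_iff (α₁ α₂ : ℕ) (α₃ : ℤ) (z : ℤ) :
    (((0 : ℚ), (0 : ℚ), (z : ℚ)) : ℚ × ℚ × ℚ) ∈ span ℤ ({((α₁ : ℚ), (0 : ℚ), (0 : ℚ)), ((α₃ : ℚ), (α₂ : ℚ), (0 : ℚ)), ((1 : ℚ), (1 : ℚ), (1 : ℚ))} : Set (ℚ × ℚ × ℚ)) ↔ ∃ b : ℤ, b * (α₂ : ℤ) = -z ∧ (α₁ : ℤ) ∣ z + b * α₃ := by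
  rw [mem_span_order₃_iff]
  constructor
  · rintro ⟨-, b, hb, a, ha⟩
    rw [zero_sub] at hb ha
    refine ⟨b, by exact_mod_cast hb, -a, ?_⟩
    have e : a * (α₁ : ℤ) = -z - b * α₃ := by exact_mod_cast ha
    linear_combination e
  · rintro ⟨b, hb, a, ha⟩
    refine ⟨⟨z, rfl⟩, b, by rw [zero_sub]; exact_mod_cast hb, -a, ?_⟩
    have : ((z + b * α₃ : ℤ) : ℚ) = ((α₁ * a : ℤ) : ℚ) := by rw [ha]
    push_cast at this ⊢
    linear_combination this

/-! ## §5 Lemma 9.5 (a), the classification: «There are no other orders», and the basis is unique (row g40-#14) -/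

/-- Reducing an integer modulo `α₁ > 0` into the window `(−½α₁, ½α₁]`. [folklore] -/
private theorem exists_window (α₁ : ℕ) (h₁ : 0 < α₁) (m : ℤ) :
    ∃ k α₃ : ℤ, m = k * α₁ + α₃ ∧ -(α₁ : ℤ) < 2 * α₃ ∧ 2 * α₃ ≤ α₁ := by
  have hα : (0 : ℤ) < α₁ := by exact_mod_cast h₁
  have h0 := Int.emod_nonneg m hα.ne'
  have h1 := Int.emod_lt_of_pos m hα
  have hdiv : m % (α₁ : ℤ) + α₁ * (m / α₁) = m := Int.emod_add_mul_ediv m α₁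
  by_cases hr : 2 * (m % α₁) ≤ α₁
  · exact ⟨m / α₁, m % α₁, by linear_combination -hdiv, by linarith, hr⟩
  · exact ⟨m / α₁ + 1, m % α₁ - α₁, by linear_combination -hdiv, by linarith, by linarith⟩

/-- **LEMMA 9.5 (a), «There are no other orders»**: every order `Λ` of `ℚe₁ ⊕ ℚe₂ ⊕ ℚe₃` (full, `1 ∈ Λ`, `ΛΛ ⊆ Λ`)
is `Λ_{α₁α₂α₃}` for a triple with `α₁, α₂ ≥ 1`, `α₃ ∈ (−½α₁, ½α₁]` and `α₁ ∣ α₃(α₂ − α₃)` — «Any full lattice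
`L ⊂ Λ_max` with `1 ∈ L` has a unique `ℤ`-basis of the shape in (9.7)»: the coordinates of `Λ` are integral,
`Λ ∩ ℤe₁ = α₁ℤe₁`, the second coordinates of `Λ ∩ (ℤe₁ + ℤe₂)` form `α₂ℤ`, and `α₃` is reduced modulo `α₁`.
[cite: HertlingLarabi2026b, §9.3 Lemma 9.5 (a) with proof, chunk p0029] -/
theorem exists_eq_span_order₃_of_isOrder {Λ : Submodule ℤ (ℚ × ℚ × ℚ)} (hΛ : IsFullLattice (ℚ × ℚ × ℚ) Λ)
    (h1 : (1 : ℚ × ℚ × ℚ) ∈ Λ) (hΛΛ : Λ * Λ ≤ Λ) :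
    ∃ (α₁ α₂ : ℕ) (α₃ : ℤ), 0 < α₁ ∧ 0 < α₂ ∧ -(α₁ : ℤ) < 2 * α₃ ∧ 2 * α₃ ≤ α₁ ∧
      (α₁ : ℤ) ∣ α₃ * (α₂ - α₃) ∧ Λ = span ℤ ({((α₁ : ℚ), (0 : ℚ), (0 : ℚ)), ((α₃ : ℚ), (α₂ : ℚ), (0 : ℚ)), ((1 : ℚ), (1 : ℚ), (1 : ℚ))} : Set (ℚ × ℚ × ℚ)) := by
  classical
  -- the three coordinates of `Λ` are integral
  have hc1 : ∀ x ∈ Λ, ∃ m : ℤ, (m : ℚ) = x.1 := fun x hx =>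
    exists_intCast_eq_map_of_one_mem (AlgHom.fst ℚ ℚ (ℚ × ℚ)) hΛ.1 h1 hΛΛ hx
  have hc2 : ∀ x ∈ Λ, ∃ m : ℤ, (m : ℚ) = x.2.1 := fun x hx =>
    exists_intCast_eq_map_of_one_mem ((AlgHom.fst ℚ ℚ ℚ).comp (AlgHom.snd ℚ ℚ (ℚ × ℚ))) hΛ.1 h1 hΛΛ hx
  have hc3 : ∀ x ∈ Λ, ∃ m : ℤ, (m : ℚ) = x.2.2 := fun x hx =>
    exists_intCast_eq_map_of_one_mem ((AlgHom.snd ℚ ℚ ℚ).comp (AlgHom.snd ℚ ℚ (ℚ × ℚ))) hΛ.1 h1 hΛΛ hx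
  -- `Λ ∩ ℚe₁ = a₁ℤ e₁`
  set ι : ℤ →ₗ[ℤ] ℚ × ℚ × ℚ := LinearMap.toSpanSingleton ℤ (ℚ × ℚ × ℚ) ((1 : ℚ), (0 : ℚ), (0 : ℚ)) with hι
  have hιz : ∀ z : ℤ, ι z = ((z : ℚ), (0 : ℚ), (0 : ℚ)) := fun z => by
    rw [hι, LinearMap.toSpanSingleton_apply]
    ext <;> simp
  obtain ⟨a₁, ha₁⟩ := (IsPrincipalIdealRing.principal (Λ.comap ι)).principal
  have hmem₁ : ∀ z : ℤ, ((z : ℚ), (0 : ℚ), (0 : ℚ)) ∈ Λ ↔ a₁ ∣ z := fun z => by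
    rw [← hιz, ← Submodule.mem_comap, ha₁, Ideal.submodule_span_eq, Ideal.mem_span_singleton]
  have ha₁0 : a₁ ≠ 0 := by
    obtain ⟨n, hn, hnΛ⟩ := hΛ.2 ((1 : ℚ), (0 : ℚ), (0 : ℚ))
    have e : (n • (((1 : ℚ), (0 : ℚ), (0 : ℚ)) : ℚ × ℚ × ℚ)) = ((n : ℚ), (0 : ℚ), (0 : ℚ)) := by ext <;> simp
    rw [e, hmem₁] at hnΛ
    rintro rfl
    exact hn (zero_dvd_iff.1 hnΛ)
  set α₁ : ℕ := a₁.natAbs with hα₁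
  have hmemα₁ : ∀ z : ℤ, ((z : ℚ), (0 : ℚ), (0 : ℚ)) ∈ Λ ↔ (α₁ : ℤ) ∣ z := fun z => by
    rw [hmem₁, hα₁, Int.natAbs_dvd]
  have hα₁pos : 0 < α₁ := Int.natAbs_pos.2 ha₁0
  -- the second coordinates of `Λ ∩ (ℚe₁ + ℚe₂)` form an ideal `a₂ℤ`
  let I₂ : Ideal ℤ :=
    { carrier := {y : ℤ | ∃ x : ℚ, ((x, (y : ℚ), (0 : ℚ)) : ℚ × ℚ × ℚ) ∈ Λ}
      add_mem' := by
        rintro y y' ⟨x, hx⟩ ⟨x', hx'⟩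
        refine ⟨x + x', ?_⟩
        have e : ((x + x', ((y + y' : ℤ) : ℚ), (0 : ℚ)) : ℚ × ℚ × ℚ) =
            (x, (y : ℚ), (0 : ℚ)) + (x', (y' : ℚ), (0 : ℚ)) := by ext <;> simp
        rw [e]; exact add_mem hx hx'
      zero_mem' := ⟨0, by rw [Int.cast_zero]; exact Λ.zero_mem⟩
      smul_mem' := by
        rintro c y ⟨x, hx⟩
        refine ⟨c * x, ?_⟩
        have e : ((c * x, ((c • y : ℤ) : ℚ), (0 : ℚ)) : ℚ × ℚ × ℚ) = c • ((x, (y : ℚ), (0 : ℚ)) : ℚ × ℚ × ℚ) := by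
          ext <;> simp [zsmul_eq_mul]
        rw [e]; exact smul_mem _ _ hx }
  obtain ⟨a₂, ha₂⟩ := (IsPrincipalIdealRing.principal I₂).principal
  have hmem₂ : ∀ y : ℤ, (∃ x : ℚ, ((x, (y : ℚ), (0 : ℚ)) : ℚ × ℚ × ℚ) ∈ Λ) ↔ a₂ ∣ y := fun y => by
    change y ∈ I₂ ↔ _
    rw [ha₂, Ideal.submodule_span_eq, Ideal.mem_span_singleton]
  have ha₂0 : a₂ ≠ 0 := by
    obtain ⟨n, hn, hnΛ⟩ := hΛ.2 ((0 : ℚ), (1 : ℚ), (0 : ℚ))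
    have e : (n • (((0 : ℚ), (1 : ℚ), (0 : ℚ)) : ℚ × ℚ × ℚ)) = ((0 : ℚ), (n : ℚ), (0 : ℚ)) := by ext <;> simp
    rw [e] at hnΛ
    have : a₂ ∣ n := (hmem₂ n).1 ⟨0, hnΛ⟩
    rintro rfl
    exact hn (zero_dvd_iff.1 this)
  set α₂ : ℕ := a₂.natAbs with hα₂
  have hα₂pos : 0 < α₂ := Int.natAbs_pos.2 ha₂0
  have hmemα₂ : ∀ y : ℤ, (∃ x : ℚ, ((x, (y : ℚ), (0 : ℚ)) : ℚ × ℚ × ℚ) ∈ Λ) ↔ (α₂ : ℤ) ∣ y := fun y => by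
    rw [hmem₂, hα₂, Int.natAbs_dvd]
  -- a vector `(m, α₂, 0) ∈ Λ`, `m ∈ ℤ`, reduced to `(α₃, α₂, 0)` with `α₃` in the window
  obtain ⟨x₂, hx₂⟩ := (hmemα₂ α₂).2 (dvd_refl _)
  obtain ⟨m, hm⟩ := hc1 _ hx₂
  simp only at hm
  obtain ⟨k, α₃, hk, hlo, hhi⟩ := exists_window α₁ hα₁pos m
  have hgen₂ : (((α₃ : ℚ), (α₂ : ℚ), (0 : ℚ)) : ℚ × ℚ × ℚ) ∈ Λ := by
    have hk1 : ((((k * α₁ : ℤ)) : ℚ), (0 : ℚ), (0 : ℚ)) ∈ Λ := (hmemα₁ _).2 (dvd_mul_left _ _)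
    have e : (((α₃ : ℚ), (α₂ : ℚ), (0 : ℚ)) : ℚ × ℚ × ℚ) =
        ((x₂, ((α₂ : ℤ) : ℚ), (0 : ℚ)) : ℚ × ℚ × ℚ) - ((((k * α₁ : ℤ)) : ℚ), (0 : ℚ), (0 : ℚ)) := by
      have hm' : x₂ = ((k * α₁ + α₃ : ℤ) : ℚ) := by rw [← hk, hm]
      rw [hm']
      ext <;> simp
    rw [e]; exact sub_mem hx₂ hk1
  refine ⟨α₁, α₂, α₃, hα₁pos, hα₂pos, hlo, hhi, ?_, ?_⟩
  · -- the order criterion, from `(α₃, α₂, 0)² ∈ Λ`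
    have hsq := hΛΛ (mul_mem_mul hgen₂ hgen₂)
    rw [Prod.mk_mul_mk, Prod.mk_mul_mk, mul_zero] at hsq
    obtain ⟨m₁, hm₁⟩ := hc1 _ hsq
    simp only at hm₁
    -- `(α₃² - α₂α₃, 0, 0) = (α₃,α₂,0)² - α₂ (α₃,α₂,0) ∈ Λ`
    have hd : ((((α₃ * α₃ - α₂ * α₃ : ℤ)) : ℚ), (0 : ℚ), (0 : ℚ)) ∈ Λ := by
      have e : (((((α₃ * α₃ - α₂ * α₃ : ℤ)) : ℚ), (0 : ℚ), (0 : ℚ)) : ℚ × ℚ × ℚ) =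
          (((α₃ : ℚ) * α₃, (α₂ : ℚ) * α₂, (0 : ℚ)) : ℚ × ℚ × ℚ) -
            (α₂ : ℤ) • (((α₃ : ℚ), (α₂ : ℚ), (0 : ℚ)) : ℚ × ℚ × ℚ) := by
        ext <;> simp [zsmul_eq_mul]
      rw [e]; exact sub_mem hsq (smul_mem _ _ hgen₂)
    obtain ⟨c, hc⟩ := (hmemα₁ _).1 hd
    exact ⟨-c, by linear_combination -hc⟩
  · refine le_antisymm (fun x hx => ?_) ?_
    · obtain ⟨m₁, hm₁⟩ := hc1 x hx
      obtain ⟨m₂, hm₂⟩ := hc2 x hx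
      obtain ⟨m₃, hm₃⟩ := hc3 x hx
      have ex : x = (((m₁ : ℚ), (m₂ : ℚ), (m₃ : ℚ)) : ℚ × ℚ × ℚ) := by
        rw [hm₁, hm₂, hm₃]
      -- `x - m₃·1 = (m₁ - m₃, m₂ - m₃, 0) ∈ Λ`, so `α₂ ∣ m₂ - m₃`
      have hv : ((((m₁ - m₃ : ℤ)) : ℚ), (((m₂ - m₃ : ℤ)) : ℚ), (0 : ℚ)) ∈ Λ := by
        have e : (((((m₁ - m₃ : ℤ)) : ℚ), (((m₂ - m₃ : ℤ)) : ℚ), (0 : ℚ)) : ℚ × ℚ × ℚ) =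
            x - m₃ • (1 : ℚ × ℚ × ℚ) := by
          rw [ex]; ext <;> simp [zsmul_eq_mul]
        rw [e]; exact sub_mem hx (smul_mem _ _ h1)
      obtain ⟨b, hb⟩ := (hmemα₂ (m₂ - m₃)).1 ⟨_, hv⟩
      -- subtract `b (α₃, α₂, 0)`: `(m₁ - m₃ - bα₃, 0, 0) ∈ Λ`, so `α₁ ∣ m₁ - m₃ - bα₃`
      have hw : ((((m₁ - m₃ - b * α₃ : ℤ)) : ℚ), (0 : ℚ), (0 : ℚ)) ∈ Λ := by
        have e : (((((m₁ - m₃ - b * α₃ : ℤ)) : ℚ), (0 : ℚ), (0 : ℚ)) : ℚ × ℚ × ℚ) =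
            (((((m₁ - m₃ : ℤ)) : ℚ), (((m₂ - m₃ : ℤ)) : ℚ), (0 : ℚ)) : ℚ × ℚ × ℚ) -
              b • (((α₃ : ℚ), (α₂ : ℚ), (0 : ℚ)) : ℚ × ℚ × ℚ) := by
          rw [hb]; ext <;> simp [zsmul_eq_mul]; ring
        rw [e]; exact sub_mem hv (smul_mem _ _ hgen₂)
      obtain ⟨a, ha⟩ := (hmemα₁ _).1 hw
      rw [ex, mem_span_order₃_iff]
      refine ⟨⟨m₃, rfl⟩, b, ?_, a, ?_⟩
      · have : (((m₂ - m₃ : ℤ)) : ℚ) = (((α₂ * b : ℤ)) : ℚ) := by rw [hb]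
        push_cast at this; linear_combination -this
      · have : (((m₁ - m₃ - b * α₃ : ℤ)) : ℚ) = (((α₁ * a : ℤ)) : ℚ) := by rw [ha]
        push_cast at this; linear_combination -this
    · rw [span_le]
      intro v hv
      simp only [Set.mem_insert_iff, Set.mem_singleton_iff] at hv
      rcases hv with rfl | rfl | rfl
      · have h := (hmemα₁ α₁).2 (dvd_refl _)
        rwa [Int.cast_natCast] at h
      · exact hgen₂
      · exact h1

/-- **LEMMA 9.5 (a), uniqueness**: `Λ_{α₁α₂α₃} = Λ_{α′₁α′₂α′₃}` with both triples normalised (`αᵢ, α′ᵢ ≥ 1`,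
`α₃, α′₃` in the windows) forces `(α₁, α₂, α₃) = (α′₁, α′₂, α′₃)` («For each order, the `ℤ`-basis in (9.7) with
(9.6) is unique»). [cite: HertlingLarabi2026b, §9.3 Lemma 9.5 (a), chunk p0029] -/
theorem span_order₃_injective {α₁ α₂ β₁ β₂ : ℕ} {α₃ β₃ : ℤ} (hα₁ : 0 < α₁) (hα₂ : 0 < α₂) (hβ₁ : 0 < β₁)
    (hβ₂ : 0 < β₂) (hlo : -(α₁ : ℤ) < 2 * α₃) (hhi : 2 * α₃ ≤ α₁) (hlo' : -(β₁ : ℤ) < 2 * β₃)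
    (hhi' : 2 * β₃ ≤ β₁) (h : span ℤ ({((α₁ : ℚ), (0 : ℚ), (0 : ℚ)), ((α₃ : ℚ), (α₂ : ℚ), (0 : ℚ)), ((1 : ℚ), (1 : ℚ), (1 : ℚ))} : Set (ℚ × ℚ × ℚ)) = span ℤ ({((β₁ : ℚ), (0 : ℚ), (0 : ℚ)), ((β₃ : ℚ), (β₂ : ℚ), (0 : ℚ)), ((1 : ℚ), (1 : ℚ), (1 : ℚ))} : Set (ℚ × ℚ × ℚ))) :
    α₁ = β₁ ∧ α₂ = β₂ ∧ α₃ = β₃ := by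
  have hαβ := (span_order₃_le_iff α₁ α₂ α₃ β₃ hβ₂.ne').1 h.le
  have hβα := (span_order₃_le_iff β₁ β₂ β₃ α₃ hα₂.ne').1 h.ge
  obtain ⟨h1, b, hb, h3⟩ := hαβ
  obtain ⟨h1', b', hb', h3'⟩ := hβα
  have e1 : α₁ = β₁ := Nat.dvd_antisymm (Int.natCast_dvd_natCast.1 h1') (Int.natCast_dvd_natCast.1 h1)
  have e2 : α₂ = β₂ := by
    refine Nat.dvd_antisymm (Int.natCast_dvd_natCast.1 ⟨b', by rw [← hb', mul_comm]⟩)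
      (Int.natCast_dvd_natCast.1 ⟨b, by rw [← hb, mul_comm]⟩)
  subst e1; subst e2
  have hb1 : b = 1 := by
    have : b * (α₂ : ℤ) = 1 * α₂ := by rw [hb, one_mul]
    exact mul_right_cancel₀ (by exact_mod_cast hα₂.ne') this
  rw [hb1, one_mul] at h3
  obtain ⟨c, hc⟩ := h3
  have hα : (0 : ℤ) < α₁ := by exact_mod_cast hα₁
  have hc1 : c < 1 := by
    by_contra hc'
    push Not at hc'
    have : (α₁ : ℤ) * 1 ≤ α₁ * c := mul_le_mul_of_nonneg_left hc' hα.le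
    linarith
  have hc2 : -1 < c := by
    by_contra hc'
    push Not at hc'
    have : (α₁ : ℤ) * c ≤ α₁ * (-1) := mul_le_mul_of_nonneg_left hc' hα.le
    linarith
  have hc0 : c = 0 := by omega
  rw [hc0, mul_zero, sub_eq_zero] at hc
  exact ⟨rfl, rfl, hc⟩

/-! ## §6 Lemma 9.5 (c) completed: `|Λ^{unit}| ≥ 4`, and the CORRECTED evaluation of `2e₂ ∈ Λ`, `2e₃ ∈ Λ` (row g40-#15) -/

/-- `|Λ^{unit}| ≥ 4 ⟺ 2e₁ ∈ Λ or 2e₂ ∈ Λ or 2e₃ ∈ Λ`: a sign vector other than `±1_A` lies in `Λ` iff some `2eᵢ`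
does («`|Λ^{unit}| = 4 ⟺ either 2e₁ ∈ Λ or 2e₂ ∈ Λ or 2e₃ ∈ Λ`» — printed as the criterion for `≥ 4`, i.e. for
`4` when not `8`). [cite: HertlingLarabi2026b, §9.3 Lemma 9.5 (c) proof, chunk p0029] -/
theorem exists_sign_mem_iff (α₁ α₂ : ℕ) (α₃ : ℤ) :
    (∃ ε₁ ε₂ ε₃ : ℤ, (ε₁ = 1 ∨ ε₁ = -1) ∧ (ε₂ = 1 ∨ ε₂ = -1) ∧ (ε₃ = 1 ∨ ε₃ = -1) ∧
        ¬(ε₁ = ε₂ ∧ ε₂ = ε₃) ∧ (((ε₁ : ℚ), (ε₂ : ℚ), (ε₃ : ℚ)) : ℚ × ℚ × ℚ) ∈ span ℤ ({((α₁ : ℚ), (0 : ℚ), (0 : ℚ)), ((α₃ : ℚ), (α₂ : ℚ), (0 : ℚ)), ((1 : ℚ), (1 : ℚ), (1 : ℚ))} : Set (ℚ × ℚ × ℚ))) ↔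
      ((((2 : ℚ), (0 : ℚ), (0 : ℚ)) : ℚ × ℚ × ℚ) ∈ span ℤ ({((α₁ : ℚ), (0 : ℚ), (0 : ℚ)), ((α₃ : ℚ), (α₂ : ℚ), (0 : ℚ)), ((1 : ℚ), (1 : ℚ), (1 : ℚ))} : Set (ℚ × ℚ × ℚ)) ∨
        (((0 : ℚ), (2 : ℚ), (0 : ℚ)) : ℚ × ℚ × ℚ) ∈ span ℤ ({((α₁ : ℚ), (0 : ℚ), (0 : ℚ)), ((α₃ : ℚ), (α₂ : ℚ), (0 : ℚ)), ((1 : ℚ), (1 : ℚ), (1 : ℚ))} : Set (ℚ × ℚ × ℚ)) ∨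
        (((0 : ℚ), (0 : ℚ), (2 : ℚ)) : ℚ × ℚ × ℚ) ∈ span ℤ ({((α₁ : ℚ), (0 : ℚ), (0 : ℚ)), ((α₃ : ℚ), (α₂ : ℚ), (0 : ℚ)), ((1 : ℚ), (1 : ℚ), (1 : ℚ))} : Set (ℚ × ℚ × ℚ))) := by
  have key : ∀ u : ℚ × ℚ × ℚ, u ∈ span ℤ ({((α₁ : ℚ), (0 : ℚ), (0 : ℚ)), ((α₃ : ℚ), (α₂ : ℚ), (0 : ℚ)), ((1 : ℚ), (1 : ℚ), (1 : ℚ))} : Set (ℚ × ℚ × ℚ)) →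
      (1 : ℚ × ℚ × ℚ) - u ∈ span ℤ ({((α₁ : ℚ), (0 : ℚ), (0 : ℚ)), ((α₃ : ℚ), (α₂ : ℚ), (0 : ℚ)), ((1 : ℚ), (1 : ℚ), (1 : ℚ))} : Set (ℚ × ℚ × ℚ)) ∧ (1 : ℚ × ℚ × ℚ) + u ∈ span ℤ ({((α₁ : ℚ), (0 : ℚ), (0 : ℚ)), ((α₃ : ℚ), (α₂ : ℚ), (0 : ℚ)), ((1 : ℚ), (1 : ℚ), (1 : ℚ))} : Set (ℚ × ℚ × ℚ)) := fun u hu =>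
    ⟨sub_mem (one_mem_span_order₃ α₁ α₂ α₃) hu, add_mem (one_mem_span_order₃ α₁ α₂ α₃) hu⟩
  have e1 : (1 : ℚ × ℚ × ℚ) = ((1 : ℚ), (1 : ℚ), (1 : ℚ)) := rfl
  constructor
  · rintro ⟨ε₁, ε₂, ε₃, h₁, h₂, h₃, hne, hmem⟩
    obtain ⟨hs, ha⟩ := key _ hmem
    rw [e1] at hs ha
    rcases h₁ with rfl | rfl <;> rcases h₂ with rfl | rfl <;> rcases h₃ with rfl | rfl
    · exact absurd ⟨rfl, rfl⟩ hne
    · right; right; convert hs using 1; ext <;> norm_num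
    · right; left; convert hs using 1; ext <;> norm_num
    · left; convert ha using 1; ext <;> norm_num
    · left; convert hs using 1; ext <;> norm_num
    · right; left; convert ha using 1; ext <;> norm_num
    · right; right; convert ha using 1; ext <;> norm_num
    · exact absurd ⟨rfl, rfl⟩ hne
  · have back : ∀ u : ℚ × ℚ × ℚ, u ∈ span ℤ ({((α₁ : ℚ), (0 : ℚ), (0 : ℚ)), ((α₃ : ℚ), (α₂ : ℚ), (0 : ℚ)), ((1 : ℚ), (1 : ℚ), (1 : ℚ))} : Set (ℚ × ℚ × ℚ)) → (1 : ℚ × ℚ × ℚ) - u ∈ span ℤ ({((α₁ : ℚ), (0 : ℚ), (0 : ℚ)), ((α₃ : ℚ), (α₂ : ℚ), (0 : ℚ)), ((1 : ℚ), (1 : ℚ), (1 : ℚ))} : Set (ℚ × ℚ × ℚ)) := fun u hu => (key u hu).1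
    rintro (h | h | h)
    · refine ⟨-1, 1, 1, Or.inr rfl, Or.inl rfl, Or.inl rfl, by omega, ?_⟩
      convert back _ h using 1; rw [e1]; ext <;> norm_num
    · refine ⟨1, -1, 1, Or.inl rfl, Or.inr rfl, Or.inl rfl, by omega, ?_⟩
      convert back _ h using 1; rw [e1]; ext <;> norm_num
    · refine ⟨1, 1, -1, Or.inl rfl, Or.inl rfl, Or.inr rfl, by omega, ?_⟩
      convert back _ h using 1; rw [e1]; ext <;> norm_num

/-- **CORRECTED `2e₂ ∈ Λ`** for a normalised triple (`α₁, α₂ ≥ 1`, `−α₁ < 2α₃ ≤ α₁`):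
`2e₂ ∈ Λ_{α₁α₂α₃} ⟺ (α₂ = 1 ∧ (α₃ = 0 ∨ 2α₃ = α₁)) ∨ (α₂ = 2 ∧ α₃ = 0)` — the printed «`(α₂, α₃) ∈ {(1,0), (2,0)}`»
plus the missing case `(α₂, α₃) = (1, α₁/2)`. [cite: HertlingLarabi2026b, §9.3 Lemma 9.5 (c) proof, chunk p0029] -/
theorem two_e₂_mem_iff_of_normalForm {α₁ α₂ : ℕ} {α₃ : ℤ} (h₁ : 0 < α₁) (h₂ : 0 < α₂) (hlo : -(α₁ : ℤ) < 2 * α₃)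
    (hhi : 2 * α₃ ≤ α₁) :
    (((0 : ℚ), (2 : ℚ), (0 : ℚ)) : ℚ × ℚ × ℚ) ∈ span ℤ ({((α₁ : ℚ), (0 : ℚ), (0 : ℚ)), ((α₃ : ℚ), (α₂ : ℚ), (0 : ℚ)), ((1 : ℚ), (1 : ℚ), (1 : ℚ))} : Set (ℚ × ℚ × ℚ)) ↔
      (α₂ = 1 ∧ (α₃ = 0 ∨ 2 * α₃ = α₁)) ∨ (α₂ = 2 ∧ α₃ = 0) := by
  rw [two_e₂_mem_iff]
  have hα : (0 : ℤ) < α₁ := by exact_mod_cast h₁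
  constructor
  · rintro ⟨b, hb, c, hc⟩
    have hα₂ : α₂ ≤ 2 := by
      have hb2 : (α₂ : ℤ) ∣ 2 := ⟨b, by rw [← hb, mul_comm]⟩
      have := Int.le_of_dvd (by norm_num) hb2; omega
    interval_cases α₂
    · have hb2 : b = 2 := by omega
      subst hb2
      have hcu : c < 2 := lt_of_mul_lt_mul_left (by linarith : (α₁ : ℤ) * c < α₁ * 2) hα.le
      have hcl : -1 < c := lt_of_mul_lt_mul_left (by linarith : (α₁ : ℤ) * (-1) < α₁ * c) hα.le
      interval_cases c
      · left; exact ⟨rfl, Or.inl (by omega)⟩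
      · left; exact ⟨rfl, Or.inr (by linarith)⟩
    · have hb1 : b = 1 := by omega
      subst hb1
      have hcu : 2 * c < 2 := by
        have : (α₁ : ℤ) * (2 * c) < α₁ * 2 := by linarith
        exact lt_of_mul_lt_mul_left this hα.le
      have hcl : -1 < 2 * c := lt_of_mul_lt_mul_left (by linarith : (α₁ : ℤ) * (-1) < α₁ * (2 * c)) hα.le
      have hc0 : c = 0 := by omega
      subst hc0
      right; exact ⟨rfl, by linarith⟩
  · rintro (⟨rfl, rfl | h⟩ | ⟨rfl, rfl⟩)
    · exact ⟨2, by simp, by simp⟩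
    · exact ⟨2, by simp, ⟨1, by linarith⟩⟩
    · exact ⟨1, by simp, by simp⟩

/-- **CORRECTED `2e₃ ∈ Λ`** for a normalised triple: `2e₃ ∈ Λ_{α₁α₂α₃} ⟺`
`(α₂ = 1 ∧ (α₃ = 1 ∨ 2α₃ = 2 − α₁ ∨ (α₁ = 1 ∧ α₃ = 0))) ∨ (α₂ = 2 ∧ (α₃ = 2 ∨ α₃ = 2 − α₁ ∨ (α₁ = 1 ∧ α₃ = 0)))`
— the printed «`(α₂, α₃) ∈ {(1,1), (2,2)}` or `(α₁, α₂, α₃) = (3, 2, −1)`» (and the `|Λ^{unit}| = 8` triples) plus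
the missing case `(α₂, α₃) = (1, 1 − α₁/2)`. [cite: HertlingLarabi2026b, §9.3 Lemma 9.5 (c) proof, chunk p0029] -/
theorem two_e₃_mem_iff_of_normalForm {α₁ α₂ : ℕ} {α₃ : ℤ} (h₁ : 0 < α₁) (h₂ : 0 < α₂) (hlo : -(α₁ : ℤ) < 2 * α₃)
    (hhi : 2 * α₃ ≤ α₁) :
    (((0 : ℚ), (0 : ℚ), (2 : ℚ)) : ℚ × ℚ × ℚ) ∈ span ℤ ({((α₁ : ℚ), (0 : ℚ), (0 : ℚ)), ((α₃ : ℚ), (α₂ : ℚ), (0 : ℚ)), ((1 : ℚ), (1 : ℚ), (1 : ℚ))} : Set (ℚ × ℚ × ℚ)) ↔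
      (α₂ = 1 ∧ (α₃ = 1 ∨ 2 * α₃ = 2 - α₁ ∨ (α₁ = 1 ∧ α₃ = 0))) ∨
        (α₂ = 2 ∧ (α₃ = 2 ∨ α₃ = 2 - α₁ ∨ (α₁ = 1 ∧ α₃ = 0))) := by
  rw [two_e₃_mem_iff]
  have hα : (0 : ℤ) < α₁ := by exact_mod_cast h₁
  constructor
  · rintro ⟨b, hb, c, hc⟩
    have hα₂ : α₂ ≤ 2 := by
      have hb2 : (α₂ : ℤ) ∣ 2 := ⟨-b, by linear_combination hb⟩
      have := Int.le_of_dvd (by norm_num) hb2; omega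
    interval_cases α₂
    · have hb2 : b = -2 := by omega
      subst hb2
      have hcu : c < 3 := lt_of_mul_lt_mul_left (by linarith : (α₁ : ℤ) * c < α₁ * 3) hα.le
      have hcl : -1 < c := lt_of_mul_lt_mul_left (by linarith : (α₁ : ℤ) * (-1) < α₁ * c) hα.le
      interval_cases c
      · left; exact ⟨rfl, Or.inl (by linarith)⟩
      · left; exact ⟨rfl, Or.inr (Or.inl (by linarith))⟩
      · left; refine ⟨rfl, Or.inr (Or.inr ⟨by omega, by omega⟩)⟩
    · have hb1 : b = -1 := by omega
      subst hb1
      have hcu : c < 3 := by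
        have : (α₁ : ℤ) * (2 * c) < α₁ * 6 := by linarith
        have := lt_of_mul_lt_mul_left this hα.le
        omega
      have hcl : -1 < c := lt_of_mul_lt_mul_left (by linarith : (α₁ : ℤ) * (-1) < α₁ * c) hα.le
      interval_cases c
      · right; exact ⟨rfl, Or.inl (by linarith)⟩
      · right; exact ⟨rfl, Or.inr (Or.inl (by linarith))⟩
      · right; refine ⟨rfl, Or.inr (Or.inr ⟨by omega, by omega⟩)⟩
  · rintro (⟨rfl, h | h | ⟨h, h'⟩⟩ | ⟨rfl, h | h | ⟨h, h'⟩⟩)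
    · exact ⟨-2, by simp, ⟨0, by subst h; ring⟩⟩
    · exact ⟨-2, by simp, ⟨1, by linear_combination -h⟩⟩
    · subst h; subst h'; exact ⟨-2, by simp, ⟨2, by norm_num⟩⟩
    · exact ⟨-1, by simp, ⟨0, by subst h; ring⟩⟩
    · exact ⟨-1, by simp, ⟨1, by linear_combination -h⟩⟩
    · subst h; subst h'; exact ⟨-1, by simp, ⟨2, by norm_num⟩⟩

end Literature.NumberTheory.ComplexMultiplication.FiniteQAlgebraLattice.SplitRankThree
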